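import Summits.QuantumFields.BalabanUV.Beta.SymAveragingHessianCounts
import Summits.QuantumFields.BalabanUV.Beta.CompositeAveragingCoarseExact

/-!
# `BalabanUV.Beta.CoclosedCovectorLinearRows` — binder row D1 ∕ (C1) OWNER an2 (gen 60): **ON A COARSE CO-CLOSED COVECTOR THE ROOTED COMB
# ROWS, THE (0.4)-SYMMETRISED ROWS AND THE STRAIGHT BLOCK-CONTOUR ROWS OF THE LINEAR AVERAGING HAVE THE SAME PAIRING** — the kernel face of
# mechanism (ii) of RULING R-D1-g59-3 (CLAIMS l.66748; Engine C `prestab/k1/K1.md` 1d0cc78cc84748f0 §6): `⟨φ, symLinAvgAt ρ A L⟩ = d!·⟨φ, contourSum L A⟩`,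
# `⟨φ, linAvgAt ρ A L⟩ = ⟨φ, contourSum L A⟩` for every finitely supported `φ` with `codiff₁ φ = 0`, every background `A`, every root `ρ`; hence per fine
# bond `f`: `⟨φ, linCountAt ρ L · · f⟩ = ⟨φ, straightCount L · · f⟩`, `⟨φ, symLinCountAt ρ L · · f⟩ = d!·⟨φ, straightCount L · · f⟩`,
# `⟨φ, symLinKerAt ρ L · · f⟩ = ⟨φ, linKerAt ρ′ L · · f⟩ = (L^d)⁻¹·⟨φ, straightCount L · · f⟩` and `⟨φ, linCountAt⟩ = L^d·⟨φ, symLinKerAt⟩`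

HONEST FRAMING (cell charter, verbatim): «discharging `BetaPertH` makes Bałaban's UV stability UNCONDITIONAL — a real constructive-QFT result; it
is NOT the continuum limit and NOT the Clay problem.»  THIS MODULE DISCHARGES NOTHING of `BetaPertH` ∕ row D1: it is [folklore] summation by parts on
`ℤ^d` over the cell's OWN typed first-order objects, BY NAME — an1's rooted comb averaging `AveragingContoursRooted.linAvgAt` with its bridge
`linAvgAt_eq_contourSum_sub_dz`, an2's symmetrised `SymmetrisedAxialPotential.symLinAvgAt` with `symLinAvgAt_eq_contourSum_sub_dz`, an2's straight
`AffineAveraging.contourSum`, the count tables `linCountAt` ∕ `symLinCountAt` ∕ `straightCount`, the mean kernels `linKerAt` ∕ `symLinKerAt`, and the cell's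
summation by parts `ResolventComposition.lip1_dz_of_finite` ∕ `KKTFluctuationEnergy.lip1_dz`.  0 `def`, 0 `def … : Prop`, 0 sorry, nothing cited; no kernel
of Bałaban's, no table VALUE, no estimate.  NOT (C1), NOT K1, NOT D1, NEVER «G-an2-4 closed», NOT BetaPertH, NOT continuum, NOT Clay.

WHY (row D1 OWNER, gen 60).  The END wrapper `FP/StepRecursionFeedNestedNamedB.d1Tel_JcComp_ctr_named` (p405971 ✓) DISPLAYS the finest KKT row (K1) of leaf-05's
tower closing, `c • E″(1) h = w • Σ_{μ,y} λ′(μ,y) · symLinKerAt ρ_c Lc μ y (·)`, as a hypothesis at every depth.  Engine C's by-value deposit (request R-AN2-59-K1,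
job j243974) found it INHABITED at depth 1 with the scalar `α = −1` for the rooted rows `linCountAt` (and for the straight rows) and `α = −81 = −3⁴` for
`symLinKerAt`, and read the mechanism (ii): «the rooted and the symmetrised rows differ from the straight contourSum rows by a COARSE-EXACT term … so for ANY
co-closed coarse covector φ: Q′ᵀφ = Cᵀφ and symLinKerAtᵀφ = Cᵀφ∕3⁴ — and λ′ is co-closed».  This file is that sentence as kernel theorems on `ℤ^d`: the
coarse-exact terms `dz (LamAt ρ A L)` ∕ `dz (SymLamAt ρ A L)` pair to ZERO with a co-closed covector (summation by parts, `codiff₁ φ = 0`), for every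
background form `A` — in particular for the indicator `δ1 f` of every fine bond, which gives the row-by-row statements on the count tables; the ratio
`linCountAt : symLinKerAt = L^d` on co-closed covectors (`= 81` at `(d, L) = (4, 3)`) is §3's last theorem.  The finitely supported case (§1–§3) is
unconditional; §4 records the bounded-covector form (periodic `λ′`, as in (K1)) under the displayed summability of the block potential and of the straight
pairing — the shape the torus instance consumes.  NOT HERE: the periodisation `perF` on the tower torus, mechanism (i) (co-closedness of the straight
system's `φ`-column) and (iii) (the block-mean dressing is a fine gradient), and (K1) itself — the road's ∕ the (C1) discharger's; nothing of them is claimed.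

WHAT (all [folklore]; `d` the lattice dimension; `⟨ψ, B⟩ := KKTFluctuationEnergy.lip1 ψ B = Σ'_y Σ_μ ψ μ y · B μ y` (the covector is written `ψ` in the code)):
* §1 `lip1_eq_sum_of_support` (a finitely supported pairing is a finite sum), `lip1_sub_right_of_support`, `lip1_const_mul_right_of_support`,
  `support_finite_of_support`, **`lip1_dz_eq_zero_of_codiff₁`** (`codiff₁ φ = 0 ⟹ ⟨φ, dz g⟩ = 0` for EVERY `g`).
* §2 **`lip1_symLinAvgAt`** (`⟨φ, symLinAvgAt ρ A L⟩ = d!·⟨φ, contourSum L A⟩`), **`lip1_linAvgAt`** (`⟨φ, linAvgAt ρ A L⟩ = ⟨φ, contourSum L A⟩`),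
  `lip1_linAvgAt_root`, `lip1_symLinAvgAt_root` (root-independence), `lip1_symLinAvgAt_eq_factorial_mul_lip1_linAvgAt`.
* §3 the count tables and mean kernels per fine bond `f`: `linCountAt_real`, `straightCount_real` (cast bridges), **`lip1_linCountAt`**, **`lip1_symLinCountAt`**,
  **`lip1_symLinKerAt`**, `lip1_linKerAt`, `lip1_symLinKerAt_eq_lip1_linKerAt`, **`lip1_linCountAt_eq_pow_mul_lip1_symLinKerAt`** (the `L^d`).
* §4 `lip1_dz_eq_zero_of_bounded`, `lip1_symLinAvgAt_of_bounded`, `lip1_linAvgAt_of_bounded` (bounded co-closed covector, summable block potential).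

HONEST DEPENDENCY (verbatim): «continuum YM on T⁴ ⇐ BetaPertH ∧ nine spine estimates (0/9 proved); BetaPertH ⇐ (D1) ∧ (D4) ∧ CAP+tail;
G-an2-4 gates asym, D1 and NE2/3/4.»  ABSOLUTE RULE (cell, verbatim): «No internally-minted statement may enter as a cited fact. Every
hypothesis is either kernel-proved in this package or a verbatim quotation of a PUBLISHED theorem with page reference.»
Unit `b2b-balaban-beta-an2` gen 60 (row-D1 owner), 2026-08-25; `bears_on: R4-O/T1|T1a` (a (C1)-side identity behind the displayed row (K1); moves no node counter).
No existing file touched.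
-/

noncomputable section

namespace Summit.QuantumFields.BalabanUV.Beta.CoclosedCovectorLinearRows

open Finset
open scoped BigOperators Nat
open Literature.MathematicalPhysics.QuantumFieldTheory.Balaban1983to89.Beta
open AffineAveraging (Form0 Form1 Site unitVec dz codiff₁ box toSite contourSum)
open AveragingContours (straightSum straightSum_eq_contourSum)
open AveragingContoursRooted (linAvgAt LamAt linAvgAt_eq_contourSum_sub_dz)
open AveragingHessianKernels (Bond δ1 straightCount straightCount_eq_straightSum)
open AveragingHessianKernelsRooted (linCountAt linKerAt linAvgAt_mapForm)
open TransportedContourVariables (mapForm mapForm_apply)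
open KKTFluctuationEnergy (lip0 lip1 lip1_dz summable_shift summable_mul_of_bdd)
open ResolventComposition (lip1_dz_of_finite)
open Summit.QuantumFields.BalabanUV.Beta.SymmetrisedAxialPotential (symLinAvgAt SymLamAt symLinAvgAt_eq_contourSum_sub_dz)
open Summit.QuantumFields.BalabanUV.Beta.SymAveragingHessianCounts (symLinCountAt symLinCountAt_real symLinKerAt)
open Summit.QuantumFields.BalabanUV.Beta.CompositeAveragingCoarseExact (linAvgAt_eq)

variable {d : ℕ}

/-! ## §1 Finitely supported covectors: the pairing is a finite sum; co-closed covectors are orthogonal to coarse gradients -/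

/-- [folklore] A pairing against a covector supported in the finite set `S` is a finite sum over `S`. -/
theorem lip1_eq_sum_of_support (ψ B : Form1 d ℝ) {S : Finset (Site d)} (hS : ∀ μ, ∀ y ∉ S, ψ μ y = 0) :
    lip1 ψ B = ∑ y ∈ S, ∑ μ, ψ μ y * B μ y := by
  unfold lip1
  exact tsum_eq_sum (s := S) fun y hy => Finset.sum_eq_zero fun μ _ => by rw [hS μ y hy, zero_mul]

/-- [folklore] Linearity of the finitely supported pairing in the second slot: differences. -/
theorem lip1_sub_right_of_support (ψ B C : Form1 d ℝ) {S : Finset (Site d)} (hS : ∀ μ, ∀ y ∉ S, ψ μ y = 0) :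
    lip1 ψ (B - C) = lip1 ψ B - lip1 ψ C := by
  rw [lip1_eq_sum_of_support ψ _ hS, lip1_eq_sum_of_support ψ B hS, lip1_eq_sum_of_support ψ C hS, ← Finset.sum_sub_distrib]
  refine Finset.sum_congr rfl fun y _ => ?_
  rw [← Finset.sum_sub_distrib]
  refine Finset.sum_congr rfl fun μ _ => ?_
  rw [Pi.sub_apply, Pi.sub_apply, mul_sub]

/-- [folklore] Linearity of the finitely supported pairing in the second slot: constant multiples. -/
theorem lip1_const_mul_right_of_support (ψ B : Form1 d ℝ) (c : ℝ) {S : Finset (Site d)} (hS : ∀ μ, ∀ y ∉ S, ψ μ y = 0) :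
    lip1 ψ (fun μ y => c * B μ y) = c * lip1 ψ B := by
  rw [lip1_eq_sum_of_support ψ _ hS, lip1_eq_sum_of_support ψ B hS, Finset.mul_sum]
  refine Finset.sum_congr rfl fun y _ => ?_
  rw [Finset.mul_sum]
  exact Finset.sum_congr rfl fun μ _ => by ring

/-- [folklore] A covector vanishing off a finite set has finitely supported components. -/
theorem support_finite_of_support (ψ : Form1 d ℝ) {S : Finset (Site d)} (hS : ∀ μ, ∀ y ∉ S, ψ μ y = 0) (κ : Fin d) :
    (Function.support (ψ κ)).Finite :=
  S.finite_toSet.subset fun y hy => by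
    by_contra h
    exact hy (hS κ y h)

/-- [folklore] **CO-CLOSED COVECTORS ARE ORTHOGONAL TO COARSE GRADIENTS**: `codiff₁ ψ = 0`, `ψ` finitely supported ⟹ `⟨ψ, dz g⟩ = 0` for EVERY
`0`-form `g` (summation by parts, `ResolventComposition.lip1_dz_of_finite`; no decay asked of `g`). -/
theorem lip1_dz_eq_zero_of_codiff₁ (ψ : Form1 d ℝ) {S : Finset (Site d)} (hS : ∀ μ, ∀ y ∉ S, ψ μ y = 0) (hco : codiff₁ ψ = 0)
    (g : Form0 d ℝ) : lip1 ψ (dz g) = 0 := by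
  rw [lip1_dz_of_finite ψ (support_finite_of_support ψ hS) g, hco]
  simp only [Pi.zero_apply, mul_zero, tsum_zero]

/-! ## §2 The three first-order rows agree on co-closed covectors -/

/-- [folklore] The symmetrised rooted averaging as a 1-form identity: `symLinAvgAt ρ A L = d!·contourSum L A − dz (SymLamAt ρ A L)`. -/
theorem symLinAvgAt_eq (ρ : Site d) (A : Form1 d ℝ) (L : ℕ) :
    (symLinAvgAt ρ A L : Form1 d ℝ) = (fun μ y => (d ! : ℝ) * contourSum L A μ y) - dz (SymLamAt ρ A L) := by
  funext μ y
  rw [Pi.sub_apply, Pi.sub_apply]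
  exact symLinAvgAt_eq_contourSum_sub_dz ρ A L μ y

/-- [folklore] **THE (0.4)-SYMMETRISED ROWS ON A CO-CLOSED COVECTOR**: `⟨ψ, symLinAvgAt ρ A L⟩ = d!·⟨ψ, contourSum L A⟩` — for every background `A`,
every root `ρ`, every scale `L` (the coarse-exact term `dz (SymLamAt ρ A L)` pairs to zero). -/
theorem lip1_symLinAvgAt (ψ : Form1 d ℝ) {S : Finset (Site d)} (hS : ∀ μ, ∀ y ∉ S, ψ μ y = 0) (hco : codiff₁ ψ = 0)
    (ρ : Site d) (A : Form1 d ℝ) (L : ℕ) :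
    lip1 ψ (symLinAvgAt ρ A L) = (d ! : ℝ) * lip1 ψ (contourSum L A) := by
  rw [symLinAvgAt_eq ρ A L, lip1_sub_right_of_support ψ _ _ hS, lip1_dz_eq_zero_of_codiff₁ ψ hS hco, sub_zero,
    lip1_const_mul_right_of_support ψ _ _ hS]

/-- [folklore] **THE ROOTED COMB ROWS ON A CO-CLOSED COVECTOR**: `⟨ψ, linAvgAt ρ A L⟩ = ⟨ψ, contourSum L A⟩` (the coarse-exact term `dz (LamAt ρ A L)`
pairs to zero). -/
theorem lip1_linAvgAt (ψ : Form1 d ℝ) {S : Finset (Site d)} (hS : ∀ μ, ∀ y ∉ S, ψ μ y = 0) (hco : codiff₁ ψ = 0)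
    (ρ : Site d) (A : Form1 d ℝ) (L : ℕ) :
    lip1 ψ (linAvgAt ρ A L) = lip1 ψ (contourSum L A) := by
  rw [linAvgAt_eq ρ A L, lip1_sub_right_of_support ψ _ _ hS, lip1_dz_eq_zero_of_codiff₁ ψ hS hco, sub_zero]

/-- [folklore] Root-independence of the rooted comb rows on co-closed covectors. -/
theorem lip1_linAvgAt_root (ψ : Form1 d ℝ) {S : Finset (Site d)} (hS : ∀ μ, ∀ y ∉ S, ψ μ y = 0) (hco : codiff₁ ψ = 0)
    (ρ ρ' : Site d) (A : Form1 d ℝ) (L : ℕ) :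
    lip1 ψ (linAvgAt ρ A L) = lip1 ψ (linAvgAt ρ' A L) := by
  rw [lip1_linAvgAt ψ hS hco, lip1_linAvgAt ψ hS hco]

/-- [folklore] Root-independence of the symmetrised rows on co-closed covectors. -/
theorem lip1_symLinAvgAt_root (ψ : Form1 d ℝ) {S : Finset (Site d)} (hS : ∀ μ, ∀ y ∉ S, ψ μ y = 0) (hco : codiff₁ ψ = 0)
    (ρ ρ' : Site d) (A : Form1 d ℝ) (L : ℕ) :
    lip1 ψ (symLinAvgAt ρ A L) = lip1 ψ (symLinAvgAt ρ' A L) := by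
  rw [lip1_symLinAvgAt ψ hS hco, lip1_symLinAvgAt ψ hS hco]

/-- [folklore] **SYMMETRISED = `d!` × ROOTED COMB on co-closed covectors**, at any two roots. -/
theorem lip1_symLinAvgAt_eq_factorial_mul_lip1_linAvgAt (ψ : Form1 d ℝ) {S : Finset (Site d)} (hS : ∀ μ, ∀ y ∉ S, ψ μ y = 0)
    (hco : codiff₁ ψ = 0) (ρ ρ' : Site d) (A : Form1 d ℝ) (L : ℕ) :
    lip1 ψ (symLinAvgAt ρ A L) = (d ! : ℝ) * lip1 ψ (linAvgAt ρ' A L) := by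
  rw [lip1_symLinAvgAt ψ hS hco, lip1_linAvgAt ψ hS hco]

/-! ## §3 The count tables and the mean kernels, fine bond by fine bond -/

/-- [folklore] Cast bridge: the rooted linear count is the rooted averaging of the real indicator form. -/
theorem linCountAt_real (ρ : Site d) (L : ℕ) (μ : Fin d) (y : Site d) (f : Bond d) :
    (linCountAt ρ L μ y f : ℝ) = linAvgAt ρ (mapForm (Int.castAddHom ℝ) (δ1 f)) L μ y := by
  rw [linAvgAt_mapForm, linCountAt]
  rfl

/-- [folklore] Cast bridge: the straight count is the straight block-contour sum of the real indicator form. -/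
theorem straightCount_real (L : ℕ) (μ : Fin d) (y : Site d) (f : Bond d) :
    (straightCount L μ y f : ℝ) = contourSum L (mapForm (Int.castAddHom ℝ) (δ1 f)) μ y := by
  rw [straightCount_eq_straightSum, straightSum_eq_contourSum]
  simp only [contourSum, mapForm_apply, Int.coe_castAddHom, Int.cast_sum]

/-- [folklore] **ROOTED COUNT ROWS = STRAIGHT COUNT ROWS on co-closed covectors** (K1.md T1 vs T1s: the same scalar `α` for `ℓ = linCountAt` and for the
straight rows): `⟨ψ, linCountAt ρ L · · f⟩ = ⟨ψ, straightCount L · · f⟩` for every fine bond `f`. -/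
theorem lip1_linCountAt (ψ : Form1 d ℝ) {S : Finset (Site d)} (hS : ∀ μ, ∀ y ∉ S, ψ μ y = 0) (hco : codiff₁ ψ = 0)
    (ρ : Site d) (L : ℕ) (f : Bond d) :
    lip1 ψ (fun μ y => (linCountAt ρ L μ y f : ℝ)) = lip1 ψ (fun μ y => (straightCount L μ y f : ℝ)) := by
  have h1 : (fun μ y => (linCountAt ρ L μ y f : ℝ)) = (linAvgAt ρ (mapForm (Int.castAddHom ℝ) (δ1 f)) L : Form1 d ℝ) := by
    funext μ y
    exact linCountAt_real ρ L μ y f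
  have h2 : (fun μ y => (straightCount L μ y f : ℝ)) = contourSum L (mapForm (Int.castAddHom ℝ) (δ1 f)) := by
    funext μ y
    exact straightCount_real L μ y f
  rw [h1, h2]
  exact lip1_linAvgAt ψ hS hco ρ _ L

/-- [folklore] **SYMMETRISED COUNT ROWS = `d!` × STRAIGHT COUNT ROWS on co-closed covectors**: `⟨ψ, symLinCountAt ρ L · · f⟩ = d!·⟨ψ, straightCount L · · f⟩`. -/
theorem lip1_symLinCountAt (ψ : Form1 d ℝ) {S : Finset (Site d)} (hS : ∀ μ, ∀ y ∉ S, ψ μ y = 0) (hco : codiff₁ ψ = 0)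
    (ρ : Site d) (L : ℕ) (f : Bond d) :
    lip1 ψ (fun μ y => (symLinCountAt ρ L μ y f : ℝ)) = (d ! : ℝ) * lip1 ψ (fun μ y => (straightCount L μ y f : ℝ)) := by
  have h1 : (fun μ y => (symLinCountAt ρ L μ y f : ℝ)) = (symLinAvgAt ρ (mapForm (Int.castAddHom ℝ) (δ1 f)) L : Form1 d ℝ) := by
    funext μ y
    exact symLinCountAt_real ρ L μ y f
  have h2 : (fun μ y => (straightCount L μ y f : ℝ)) = contourSum L (mapForm (Int.castAddHom ℝ) (δ1 f)) := by
    funext μ y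
    exact straightCount_real L μ y f
  rw [h1, h2]
  exact lip1_symLinAvgAt ψ hS hco ρ _ L

/-- [folklore] **THE (0.4) MEAN LINEAR KERNEL ON A CO-CLOSED COVECTOR**: `⟨ψ, symLinKerAt ρ L · · f⟩ = (L^d)⁻¹·⟨ψ, straightCount L · · f⟩` (the `d!` of
the symmetrisation cancels against `symLinKerAt`'s normalisation `(d!·L^d)⁻¹`). -/
theorem lip1_symLinKerAt (ψ : Form1 d ℝ) {S : Finset (Site d)} (hS : ∀ μ, ∀ y ∉ S, ψ μ y = 0) (hco : codiff₁ ψ = 0)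
    (ρ : Site d) (L : ℕ) (f : Bond d) :
    lip1 ψ (fun μ y => symLinKerAt ρ L μ y f) = ((L : ℝ) ^ d)⁻¹ * lip1 ψ (fun μ y => (straightCount L μ y f : ℝ)) := by
  have hfac : (d ! : ℝ) ≠ 0 := by exact_mod_cast Nat.factorial_ne_zero d
  have h : (fun μ y => symLinKerAt ρ L μ y f) = fun μ y => ((d ! : ℝ) * (L : ℝ) ^ d)⁻¹ * (symLinCountAt ρ L μ y f : ℝ) := by
    funext μ y
    rw [symLinKerAt, div_eq_inv_mul]
  rw [h, lip1_const_mul_right_of_support ψ _ _ hS, lip1_symLinCountAt ψ hS hco ρ L f, ← mul_assoc, mul_inv, mul_assoc ((d ! : ℝ))⁻¹,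
    mul_comm (((L : ℝ) ^ d)⁻¹) (d ! : ℝ), ← mul_assoc, inv_mul_cancel₀ hfac, one_mul]

/-- [folklore] The comb's mean linear kernel on a co-closed covector: `⟨ψ, linKerAt ρ L · · f⟩ = (L^d)⁻¹·⟨ψ, straightCount L · · f⟩`. -/
theorem lip1_linKerAt (ψ : Form1 d ℝ) {S : Finset (Site d)} (hS : ∀ μ, ∀ y ∉ S, ψ μ y = 0) (hco : codiff₁ ψ = 0)
    (ρ : Site d) (L : ℕ) (f : Bond d) :
    lip1 ψ (fun μ y => linKerAt ρ L μ y f) = ((L : ℝ) ^ d)⁻¹ * lip1 ψ (fun μ y => (straightCount L μ y f : ℝ)) := by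
  have h : (fun μ y => linKerAt ρ L μ y f) = fun μ y => ((L : ℝ) ^ d)⁻¹ * (linCountAt ρ L μ y f : ℝ) := by
    funext μ y
    rw [linKerAt, div_eq_inv_mul]
  rw [h, lip1_const_mul_right_of_support ψ _ _ hS, lip1_linCountAt ψ hS hco ρ L f]

/-- [folklore] **THE TWO MEAN LINEAR KERNELS HAVE THE SAME CO-CLOSED MOMENTS** (comb vs (0.4)-symmetrised, at any two roots):
`⟨ψ, symLinKerAt ρ L · · f⟩ = ⟨ψ, linKerAt ρ′ L · · f⟩`. -/
theorem lip1_symLinKerAt_eq_lip1_linKerAt (ψ : Form1 d ℝ) {S : Finset (Site d)} (hS : ∀ μ, ∀ y ∉ S, ψ μ y = 0) (hco : codiff₁ ψ = 0)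
    (ρ ρ' : Site d) (L : ℕ) (f : Bond d) :
    lip1 ψ (fun μ y => symLinKerAt ρ L μ y f) = lip1 ψ (fun μ y => linKerAt ρ' L μ y f) := by
  rw [lip1_symLinKerAt ψ hS hco, lip1_linKerAt ψ hS hco]

/-- [folklore] **THE SCALAR BETWEEN THE TWO DISPLAYED ROW NORMALISATIONS** (K1.md: `α = −1` for `ℓ = linCountAt`, `α = −81 = −3⁴` for `ℓ = symLinKerAt` at
`(d, L) = (4, 3)`): on a co-closed covector `⟨ψ, linCountAt ρ L · · f⟩ = L^d·⟨ψ, symLinKerAt ρ′ L · · f⟩` (`L ≠ 0`). -/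
theorem lip1_linCountAt_eq_pow_mul_lip1_symLinKerAt (ψ : Form1 d ℝ) {S : Finset (Site d)} (hS : ∀ μ, ∀ y ∉ S, ψ μ y = 0)
    (hco : codiff₁ ψ = 0) (ρ ρ' : Site d) {L : ℕ} (hL : L ≠ 0) (f : Bond d) :
    lip1 ψ (fun μ y => (linCountAt ρ L μ y f : ℝ)) = (L : ℝ) ^ d * lip1 ψ (fun μ y => symLinKerAt ρ' L μ y f) := by
  have hLd : (L : ℝ) ^ d ≠ 0 := pow_ne_zero d (Nat.cast_ne_zero.mpr hL)
  rw [lip1_symLinKerAt ψ hS hco, lip1_linCountAt ψ hS hco, ← mul_assoc, mul_inv_cancel₀ hLd, one_mul]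

/-! ## §4 Bounded covectors (e.g. periodic ones) against a summable block potential -/

/-- [folklore] A BOUNDED co-closed covector is orthogonal to the coarse gradient of every SUMMABLE `0`-form (`KKTFluctuationEnergy.lip1_dz`). -/
theorem lip1_dz_eq_zero_of_bounded {ψ : Form1 d ℝ} {M : ℝ} (hψ : ∀ μ y, |ψ μ y| ≤ M) (hco : codiff₁ ψ = 0) {g : Form0 d ℝ}
    (hg : Summable g) : lip1 ψ (dz g) = 0 := by
  rw [lip1_dz hψ hg, hco]
  simp only [lip0, Pi.zero_apply, zero_mul, tsum_zero]

/-- [folklore] The pairing of a bounded covector with the coarse gradient of a summable `0`-form is summable termwise in `y`. -/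
theorem summable_pairing_dz {ψ : Form1 d ℝ} {M : ℝ} (hψ : ∀ μ y, |ψ μ y| ≤ M) {g : Form0 d ℝ} (hg : Summable g) :
    Summable fun y => ∑ μ, ψ μ y * dz g μ y := by
  refine summable_sum fun μ _ => ?_
  have h1 : Summable fun y => ψ μ y * g (y + unitVec μ) := summable_mul_of_bdd (hψ μ) (summable_shift hg _)
  have h2 : Summable fun y => ψ μ y * g y := summable_mul_of_bdd (hψ μ) hg
  exact (h1.sub h2).congr fun y => by simp only [dz]; ring

/-- [folklore] **THE SYMMETRISED ROWS ON A BOUNDED CO-CLOSED COVECTOR** (the shape (K1) consumes: a periodic `λ′`): if the symmetrised block potential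
`SymLamAt ρ A L` is summable and the straight pairing converges, then `⟨ψ, symLinAvgAt ρ A L⟩ = d!·⟨ψ, contourSum L A⟩`. -/
theorem lip1_symLinAvgAt_of_bounded {ψ : Form1 d ℝ} {M : ℝ} (hψ : ∀ μ y, |ψ μ y| ≤ M) (hco : codiff₁ ψ = 0) (ρ : Site d)
    (A : Form1 d ℝ) (L : ℕ) (hΛ : Summable (SymLamAt ρ A L)) (hC : Summable fun y => ∑ μ, ψ μ y * contourSum L A μ y) :
    lip1 ψ (symLinAvgAt ρ A L) = (d ! : ℝ) * lip1 ψ (contourSum L A) := by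
  have hC' : Summable fun y => ∑ μ, ψ μ y * ((d ! : ℝ) * contourSum L A μ y) :=
    (hC.mul_left (d ! : ℝ)).congr fun y => by rw [Finset.mul_sum]; exact Finset.sum_congr rfl fun μ _ => by ring
  have hD := summable_pairing_dz hψ hΛ
  have hz := lip1_dz_eq_zero_of_bounded hψ hco hΛ
  unfold lip1 at hz ⊢
  calc ∑' y, ∑ μ, ψ μ y * symLinAvgAt ρ A L μ y
      = ∑' y, ((∑ μ, ψ μ y * ((d ! : ℝ) * contourSum L A μ y)) - ∑ μ, ψ μ y * dz (SymLamAt ρ A L) μ y) := by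
        refine tsum_congr fun y => ?_
        rw [← Finset.sum_sub_distrib]
        exact Finset.sum_congr rfl fun μ _ => by rw [symLinAvgAt_eq_contourSum_sub_dz, mul_sub]
    _ = ∑' y, ∑ μ, ψ μ y * ((d ! : ℝ) * contourSum L A μ y) := by rw [hC'.tsum_sub hD, hz, sub_zero]
    _ = (d ! : ℝ) * ∑' y, ∑ μ, ψ μ y * contourSum L A μ y := by
        rw [← tsum_mul_left]
        exact tsum_congr fun y => by rw [Finset.mul_sum]; exact Finset.sum_congr rfl fun μ _ => by ring

/-- [folklore] **THE ROOTED COMB ROWS ON A BOUNDED CO-CLOSED COVECTOR**: if `LamAt ρ A L` is summable and the straight pairing converges, then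
`⟨ψ, linAvgAt ρ A L⟩ = ⟨ψ, contourSum L A⟩`. -/
theorem lip1_linAvgAt_of_bounded {ψ : Form1 d ℝ} {M : ℝ} (hψ : ∀ μ y, |ψ μ y| ≤ M) (hco : codiff₁ ψ = 0) (ρ : Site d)
    (A : Form1 d ℝ) (L : ℕ) (hΛ : Summable (LamAt ρ A L)) (hC : Summable fun y => ∑ μ, ψ μ y * contourSum L A μ y) :
    lip1 ψ (linAvgAt ρ A L) = lip1 ψ (contourSum L A) := by
  have hD := summable_pairing_dz hψ hΛ
  have hz := lip1_dz_eq_zero_of_bounded hψ hco hΛ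
  unfold lip1 at hz ⊢
  calc ∑' y, ∑ μ, ψ μ y * linAvgAt ρ A L μ y
      = ∑' y, ((∑ μ, ψ μ y * contourSum L A μ y) - ∑ μ, ψ μ y * dz (LamAt ρ A L) μ y) := by
        refine tsum_congr fun y => ?_
        rw [← Finset.sum_sub_distrib]
        exact Finset.sum_congr rfl fun μ _ => by rw [linAvgAt_eq_contourSum_sub_dz, mul_sub]
    _ = ∑' y, ∑ μ, ψ μ y * contourSum L A μ y := by rw [hC.tsum_sub hD, hz, sub_zero]

end Summit.QuantumFields.BalabanUV.Beta.CoclosedCovectorLinearRows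

end
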